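import Literature.Geometry.Riemannian.GurskyEinsteinGapProofs
import HarnessLib

/-!
# Gursky's Einstein gap on homotopy `4`-spheres (`gursky_einstein_homotopySphere_four`): fact split
# (D-0027 A7 exception, batch libsplit-26)

Split file for the XL named fact `Literature.Geometry.Riemannian.gursky_einstein_homotopySphere_four`
(`GurskyEinsteinGap.lean`; Gursky 2000, Thm. 1 + Chern–Gauss–Bonnet + signature formula: an Einstein
metric `Ric = λ g`, `λ > 0`, on a closed smooth `M ≃ₕ S⁴` has `W ≡ 0` or `vol(M, g) ≤ 8π²/λ²`).
The sibling `GurskyEinsteinGapProofs.lean` PROVES the reduction of the fact to FOUR printed global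
statements (`gursky_einstein_homotopySphere_four_of_oriented`, whose hypotheses `hThm1`, `hCor1`,
`hSig`, `hGB` are copied below VERBATIM as named facts), together with the pointwise algebra of
Gursky–LeBrun's argument (`3√6 det W⁺ ≤ |W⁺|³`, the numerology of Lemma 4, the Yamabe chain).
This file turns those four hypotheses into the CHILDREN of the split and proves the assembly.

Dictionary (as in the Proofs file): the chiral Weyl norms are read frame-wise and orientation-wise
— given a smooth orientation `o` of `M` (`Topology/FourManifolds/SmoothOrientation.lean`), a
function `w₊ : M → ℝ` (resp. `w₋`) is "a version of `|W⁺|²`" (resp. `|W⁻|²`, the `End(Λ^±)`-norms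
of Gursky–LeBrun) when at every point some positively `o`-oriented `g`-orthonormal frame `e` has
`w₊(x) = ¼‖A(e) − (tr A(e)/3)·1‖²_F` (resp. with Hamilton's block `C`), `A, C` the self-dual /
anti-self-dual blocks of the Levi-Civita curvature operator (`CurvatureDecomposition.lean`); the
value does not depend on the positive orthonormal frame, so these are THE functions `|W^±|²`.
Integrals are `∫⁻ … ∂(riemannianMeasure g)`, `vol = riemannianMeasure g univ`, and for `Ric = λ g`
one has `∫ s²/24 dμ = (2λ²/3) vol`. All four statements are specialised, as in the parent, to
closed smooth `M ≃ₕ S⁴` (so `χ(M) = 2`, `τ(M) = 0`) carrying an Einstein metric with `λ > 0`.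

* `GurskyLeBrun1999_thm1_homotopySphere` — Gursky–LeBrun 1999, Thm. 1 (= Gursky 2000, Thm. 1 in
  the Einstein case): `W⁺ ≢ 0 ⟹ ∫|W⁺|² dμ ≥ ∫ s²/24 dμ`;
* `GurskyLeBrun1999_cor1_homotopySphere` — ibid. Cor. 1 (i), the mirror statement for `W⁻`;
* `signatureFormula_weyl_homotopySphere_four` — the Hirzebruch signature formula
  `12π² τ(M) = ∫(|W⁺|² − |W⁻|²) dμ` (Besse 6.34) with `τ(M) = 0`: `∫|W⁺|² = ∫|W⁻|²`;
* `chernGaussBonnet_einstein_homotopySphere_four` — the Chern–Gauss–Bonnet formula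
  `8π² χ(M) = ∫(|W⁺|² + |W⁻|² + s²/24 − |r̊|²/2) dμ` (Besse 6.31–6.32) with `r̊ = 0`, `χ(M) = 2`:
  `∫|W⁺|² + ∫|W⁻|² + (2λ²/3) vol = 16π²`;
* `gursky_einstein_homotopySphere_four_holds_of` — the parent from the four children (PROVED: it is
  `gursky_einstein_homotopySphere_four_of_oriented`).

None of the four is in reach of the tree today (no Chern–Weil theory / Euler class and signature
as curvature integrals, no Yamabe–Obata theorem, no Weitzenböck formula for `W⁺`); they are four
independent classical targets, each one printed statement.

## References

* [Gursky2000] M. J. Gursky, Math. Ann. 318 (2000) 417–431, Thm. 1.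
* [GurskyLebrun1999] M. J. Gursky, C. LeBrun, Ann. Global Anal. Geom. 17 (1999) 315–328
  (arXiv:math/9807055), §2 (gb), (sig); §3 Thm. 1, Cor. 1; §5.
* [Besse1987] A. L. Besse, Einstein Manifolds (1987), 6.31, 6.32, 6.34, 16.24 (i).
-/

noncomputable section

open MeasureTheory Finset Matrix
open scoped Manifold ContDiff ENNReal ContinuousMap

namespace Literature.Geometry.Riemannian

open Literature.Geometry.Lorentzian (PseudoRiemannianMetric riemannianMeasure)
open Literature.Geometry.Lorentzian.PseudoRiemannianMetric
open Literature.Topology.FourManifolds (SmoothOrientation)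

/-- **Gursky–LeBrun 1999, Theorem 1 (= Gursky 2000, Thm. 1, Einstein case), on homotopy
`4`-spheres** — CHILD 1 of the split of `gursky_einstein_homotopySphere_four`. "Let `(M,g)` be a
compact oriented Einstein `4`-manifold with `s > 0` and `W⁺ ≢ 0`. Then
`∫_M |W⁺_g|²_g dμ_g ≥ ∫_M s_g²/24 dμ_g`." Here for closed smooth `M ≃ₕ S⁴`, `Ric = λ g` with `λ > 0`
(so `s = 4λ`, `∫ s²/24 = (2λ²/3) vol`), an orientation `o`, and `w₊` a version of `|W⁺|²` (at each
point `¼‖A(e) − (tr A(e)/3)1‖²_F` in some positive orthonormal frame `e`): if `w₊ ≢ 0` then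
`(2λ²/3) vol ≤ ∫⁻ w₊ dμ`. Verbatim the hypothesis `hThm1` of
`gursky_einstein_homotopySphere_four_of_oriented`.
[cite: GurskyLebrun1999, §3 Theorem 1] [cite: Gursky2000, Theorem 1] -/
def GurskyLeBrun1999_thm1_homotopySphere : Prop :=
  ∀ (M : Type) [TopologicalSpace M] [T2Space M] [SecondCountableTopology M]
    [ChartedSpace (EuclideanSpace ℝ (Fin 4)) M] [IsManifold (𝓡 4) ∞ M] [CompactSpace M]
    [T3Space M] [MeasurableSpace M] [BorelSpace M],
    M ≃ₕ Metric.sphere (0 : EuclideanSpace ℝ (Fin 5)) 1 →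
    ∀ (g : PseudoRiemannianMetric (𝓡 4) ∞ (EuclideanSpace ℝ (Fin 4))
        (TangentSpace (𝓡 4) : M → Type _))
      [g.HasLeviCivita] (hg : g.IsRiemannian) (lam : ℝ), 0 < lam →
      (∀ (x : M) (X Y : TangentSpace (𝓡 4) x), g.ricci x X Y = lam * g.val x X Y) →
      ∀ (o : SmoothOrientation (𝓡 4) M) (wp : M → ℝ),
      (∀ x, ∃ e : Fin 4 → TangentSpace (𝓡 4) x, g.IsOrthonormalFrame x e ∧
        o.IsPosFrame x (frameOfFin e) ∧
        wp x = (1 / 4 : ℝ) * ∑ i : Fin 3, ∑ j : Fin 3,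
          ((g.blockA g.leviCivita x e -
            ((g.blockA g.leviCivita x e).trace / 3) • (1 : Matrix (Fin 3) (Fin 3) ℝ)) i j) ^ 2) →
      (∃ x, wp x ≠ 0) →
      ENNReal.ofReal (2 * lam ^ 2 / 3) *
          riemannianMeasure (g.toContMDiffRiemannianMetric hg) Set.univ ≤
        ∫⁻ x, ENNReal.ofReal (wp x) ∂riemannianMeasure (g.toContMDiffRiemannianMetric hg)

/-- **Gursky–LeBrun 1999, Corollary 1 (i) (the mirror of Theorem 1, for `W⁻`), on homotopy
`4`-spheres** — CHILD 2 of the split of `gursky_einstein_homotopySphere_four`. For closed smooth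
`M ≃ₕ S⁴`, `Ric = λ g` with `λ > 0`, an orientation `o` and `w₋` a version of `|W⁻|²`
(`¼‖C(e) − (tr C(e)/3)1‖²_F` in positive orthonormal frames, Hamilton's anti-self-dual block `C`):
if `w₋ ≢ 0` then `(2λ²/3) vol ≤ ∫⁻ w₋ dμ` ("reading this in the mirror", i.e. Theorem 1 for the
reversed orientation). Verbatim the hypothesis `hCor1` of
`gursky_einstein_homotopySphere_four_of_oriented`.
[cite: GurskyLebrun1999, §3 Corollary 1] [cite: Gursky2000, Theorem 1] -/
def GurskyLeBrun1999_cor1_homotopySphere : Prop :=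
  ∀ (M : Type) [TopologicalSpace M] [T2Space M] [SecondCountableTopology M]
    [ChartedSpace (EuclideanSpace ℝ (Fin 4)) M] [IsManifold (𝓡 4) ∞ M] [CompactSpace M]
    [T3Space M] [MeasurableSpace M] [BorelSpace M],
    M ≃ₕ Metric.sphere (0 : EuclideanSpace ℝ (Fin 5)) 1 →
    ∀ (g : PseudoRiemannianMetric (𝓡 4) ∞ (EuclideanSpace ℝ (Fin 4))
        (TangentSpace (𝓡 4) : M → Type _))
      [g.HasLeviCivita] (hg : g.IsRiemannian) (lam : ℝ), 0 < lam →
      (∀ (x : M) (X Y : TangentSpace (𝓡 4) x), g.ricci x X Y = lam * g.val x X Y) →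
      ∀ (o : SmoothOrientation (𝓡 4) M) (wm : M → ℝ),
      (∀ x, ∃ e : Fin 4 → TangentSpace (𝓡 4) x, g.IsOrthonormalFrame x e ∧
        o.IsPosFrame x (frameOfFin e) ∧
        wm x = (1 / 4 : ℝ) * ∑ i : Fin 3, ∑ j : Fin 3,
          ((g.blockC g.leviCivita x e -
            ((g.blockC g.leviCivita x e).trace / 3) • (1 : Matrix (Fin 3) (Fin 3) ℝ)) i j) ^ 2) →
      (∃ x, wm x ≠ 0) →
      ENNReal.ofReal (2 * lam ^ 2 / 3) *
          riemannianMeasure (g.toContMDiffRiemannianMetric hg) Set.univ ≤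
        ∫⁻ x, ENNReal.ofReal (wm x) ∂riemannianMeasure (g.toContMDiffRiemannianMetric hg)

/-- **The Hirzebruch signature formula for the Weyl tensor, with `τ(M) = 0` for `M ≃ₕ S⁴`** —
CHILD 3 of the split of `gursky_einstein_homotopySphere_four`. Printed: `12π² τ(M) =
∫_M (|W₊|² − |W₋|²) dμ` for a compact oriented Riemannian `4`-manifold (Besse 1987, 6.34;
Gursky–LeBrun (sig)), and `τ(M) = 0` for `M ≃ₕ S⁴` (`H²(M) = 0`). Here for closed smooth
`M ≃ₕ S⁴` with an Einstein metric `Ric = λ g`, `λ > 0` (the only case the parent needs), an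
orientation `o`, and `w₊, w₋` versions of `|W⁺|², |W⁻|²` read in common positive orthonormal frames:
`∫⁻ w₊ dμ = ∫⁻ w₋ dμ`. Verbatim the hypothesis `hSig` of
`gursky_einstein_homotopySphere_four_of_oriented`.
[cite: Besse1987, 6.34] [cite: GurskyLebrun1999, §2 (sig)] -/
def signatureFormula_weyl_homotopySphere_four : Prop :=
  ∀ (M : Type) [TopologicalSpace M] [T2Space M] [SecondCountableTopology M]
    [ChartedSpace (EuclideanSpace ℝ (Fin 4)) M] [IsManifold (𝓡 4) ∞ M] [CompactSpace M]
    [T3Space M] [MeasurableSpace M] [BorelSpace M],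
    M ≃ₕ Metric.sphere (0 : EuclideanSpace ℝ (Fin 5)) 1 →
    ∀ (g : PseudoRiemannianMetric (𝓡 4) ∞ (EuclideanSpace ℝ (Fin 4))
        (TangentSpace (𝓡 4) : M → Type _))
      [g.HasLeviCivita] (hg : g.IsRiemannian) (lam : ℝ), 0 < lam →
      (∀ (x : M) (X Y : TangentSpace (𝓡 4) x), g.ricci x X Y = lam * g.val x X Y) →
      ∀ (o : SmoothOrientation (𝓡 4) M) (wp wm : M → ℝ),
      (∀ x, ∃ e : Fin 4 → TangentSpace (𝓡 4) x, g.IsOrthonormalFrame x e ∧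
        o.IsPosFrame x (frameOfFin e) ∧
        wp x = (1 / 4 : ℝ) * ∑ i : Fin 3, ∑ j : Fin 3,
          ((g.blockA g.leviCivita x e -
            ((g.blockA g.leviCivita x e).trace / 3) • (1 : Matrix (Fin 3) (Fin 3) ℝ)) i j) ^ 2 ∧
        wm x = (1 / 4 : ℝ) * ∑ i : Fin 3, ∑ j : Fin 3,
          ((g.blockC g.leviCivita x e -
            ((g.blockC g.leviCivita x e).trace / 3) • (1 : Matrix (Fin 3) (Fin 3) ℝ)) i j) ^ 2) →
      ∫⁻ x, ENNReal.ofReal (wp x) ∂riemannianMeasure (g.toContMDiffRiemannianMetric hg) =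
        ∫⁻ x, ENNReal.ofReal (wm x) ∂riemannianMeasure (g.toContMDiffRiemannianMetric hg)

/-- **The Chern–Gauss–Bonnet formula for an Einstein metric on `M ≃ₕ S⁴` (`χ(M) = 2`)** —
CHILD 4 of the split of `gursky_einstein_homotopySphere_four`. Printed: `8π² χ(M) =
∫_M (|W₊|² + |W₋|² + s²/24 − |r̊|²/2) dμ` for a compact oriented Riemannian `4`-manifold (Besse
1987, 6.31, with 6.32: `r̊ = 0` for Einstein metrics; Gursky–LeBrun (gb)), and `χ(M) = χ(S⁴) = 2`
for `M ≃ₕ S⁴`. Here for closed smooth `M ≃ₕ S⁴`, `Ric = λ g` with `λ > 0` (`s = 4λ`,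
`∫ s²/24 dμ = (2λ²/3) vol`), an orientation `o`, and `w₊, w₋` versions of `|W⁺|², |W⁻|²` in common
positive orthonormal frames: `∫⁻ w₊ dμ + ∫⁻ w₋ dμ + (2λ²/3) vol = 16π²`. Verbatim the hypothesis
`hGB` of `gursky_einstein_homotopySphere_four_of_oriented`.
[cite: Besse1987, 6.31 and 6.32] [cite: GurskyLebrun1999, §2 (gb)] -/
def chernGaussBonnet_einstein_homotopySphere_four : Prop :=
  ∀ (M : Type) [TopologicalSpace M] [T2Space M] [SecondCountableTopology M]
    [ChartedSpace (EuclideanSpace ℝ (Fin 4)) M] [IsManifold (𝓡 4) ∞ M] [CompactSpace M]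
    [T3Space M] [MeasurableSpace M] [BorelSpace M],
    M ≃ₕ Metric.sphere (0 : EuclideanSpace ℝ (Fin 5)) 1 →
    ∀ (g : PseudoRiemannianMetric (𝓡 4) ∞ (EuclideanSpace ℝ (Fin 4))
        (TangentSpace (𝓡 4) : M → Type _))
      [g.HasLeviCivita] (hg : g.IsRiemannian) (lam : ℝ), 0 < lam →
      (∀ (x : M) (X Y : TangentSpace (𝓡 4) x), g.ricci x X Y = lam * g.val x X Y) →
      ∀ (o : SmoothOrientation (𝓡 4) M) (wp wm : M → ℝ),
      (∀ x, ∃ e : Fin 4 → TangentSpace (𝓡 4) x, g.IsOrthonormalFrame x e ∧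
        o.IsPosFrame x (frameOfFin e) ∧
        wp x = (1 / 4 : ℝ) * ∑ i : Fin 3, ∑ j : Fin 3,
          ((g.blockA g.leviCivita x e -
            ((g.blockA g.leviCivita x e).trace / 3) • (1 : Matrix (Fin 3) (Fin 3) ℝ)) i j) ^ 2 ∧
        wm x = (1 / 4 : ℝ) * ∑ i : Fin 3, ∑ j : Fin 3,
          ((g.blockC g.leviCivita x e -
            ((g.blockC g.leviCivita x e).trace / 3) • (1 : Matrix (Fin 3) (Fin 3) ℝ)) i j) ^ 2) →
      ∫⁻ x, ENNReal.ofReal (wp x) ∂riemannianMeasure (g.toContMDiffRiemannianMetric hg) +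
          ∫⁻ x, ENNReal.ofReal (wm x) ∂riemannianMeasure (g.toContMDiffRiemannianMetric hg) +
          ENNReal.ofReal (2 * lam ^ 2 / 3) *
            riemannianMeasure (g.toContMDiffRiemannianMetric hg) Set.univ =
        ENNReal.ofReal (16 * Real.pi ^ 2)

/-- **Assembly of the split (PROVED):** Gursky's gap `gursky_einstein_homotopySphere_four` from its
four children — Gursky–LeBrun Thm. 1, Cor. 1, the signature formula with `τ = 0` and
Chern–Gauss–Bonnet with `χ = 2` — by the oriented reduction of the Proofs file
(`gursky_einstein_homotopySphere_four_of_oriented`: `M` simply connected ⟹ orientable; positive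
orthonormal frames exist; if `w⁺ ≢ 0` or `w⁻ ≢ 0` the volume bound, else `W ≡ 0`).
[cite: Gursky2000, Theorem 1] [cite: GurskyLebrun1999, §5] -/
theorem gursky_einstein_homotopySphere_four_holds_of
    (h₁ : GurskyLeBrun1999_thm1_homotopySphere) (h₂ : GurskyLeBrun1999_cor1_homotopySphere)
    (h₃ : signatureFormula_weyl_homotopySphere_four)
    (h₄ : chernGaussBonnet_einstein_homotopySphere_four) :
    gursky_einstein_homotopySphere_four :=
  gursky_einstein_homotopySphere_four_of_oriented h₁ h₂ h₃ h₄

end Literature.Geometry.Riemannian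

end
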